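import Literature.MathematicalPhysics.QuantumFieldTheory.Balaban1983to89.B8SockHFPAssembly
import Literature.MathematicalPhysics.QuantumFieldTheory.Balaban1983to89.B8SockHFPWindows
import Literature.MathematicalPhysics.QuantumFieldTheory.Balaban1983to89.B8LeafModelZdSockLetters

/-!
# `Balaban1983to89.B8SockHFPOfSockLetters` — [Balaban1985RegularSpaces] Prop. 5 p. 94 / Thm 4 p. 88: THE PROPOSITION-5 FIXED-POINT SOCKETS `SockHFP₀`, `SockHFP`
# OF THE N05 KNIT, PROVED FROM THE [4]-LETTERS SOCKET — the tranche-2 assembly `B8SockHFPAssembly` (datum level) composed with the windows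
# `B8SockHFPWindows.hfpWindows_of_guard` and the letters package `B8LeafModelZdSockLetters.SockLetters`, below ONE threshold

statement-level skeleton of published theorems with citation tags; proofs where landed; nothing here is a claim about the
Yang–Mills mass gap

PDF held: `paper:balaban1985-cmp99-regular-spaces-gauge-fixing` (journal page = PDF page + 74); pp. 88–89 (Thm 4), pp. 91–94 (Sect. D, Prop. 5 (1.106)–(1.109)).

WHY THIS FILE (cell `pub-ymgap`, R134 acceleration seat `pub-ymgap-dag-n05-d`, strategy s2 of DAG node N05 = [B8]; dag-lead REBALANCE №51 (ii): the socket-form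
assembly — `pub-ymgap-dag-n19-b`'s reserved `sockHFP_of_letters` is untouched; count-neutral).  The knit `B8LeafKnitZd3B9All.b8LeafRS_zd3_univ_b9all` (n05-a g6)
carries FOUR sockets per member; two of them, `B8LeafModelZdOfHFP.SockHFP₀` / `SockHFP` (Proposition 5's fixed point in plain currency, base datum and level-`m`
datum), are PROVED here from: the [4]-LETTERS socket `SockLetters L B_G B_R B₀′_H B₂′ c_L η k Ω Λs` ([4] Thms 3.1–3.3 for Bałaban's operators, ONE hypothesis per
member), the b9 socket in Proposition 3's frame at every truncation `∀ m ≤ k, SockB9P3 … m …` (dag-n06-b's supply shape, fed by `B8LeafSocketsB9OfThm33.sB9all_of_thm33`),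
and the member's geometry laws NOT carried by `ZdIdx` — towers inside `Ω_j` AT EVERY TRUNCATION and INDEX LAW №8 («`Λs m` is the truncation of `Λs (m+1)`», p. 89) —
below ONE threshold `c_F = min(c_P, c_L)`, `c_P` the windows threshold of `hfpWindows_of_guard` (free-constant condition `3·(2dL²)·B_G·B_R ≤ B₀′` displayed).

WHAT THIS FILE PROVES (kernel, 0 sorry, theorems only):
* §1 `sockHFP_of_sockLetters` / `sockHFP₀_of_sockLetters` — the sockets at ONE member from `SockLetters`, `SB9all`, the geometry laws and a windows family below `c_P`
  (`B8SockHFPAssembly.sockHFP_body_of_join` / `sockHFP₀_body_of_join` BY NAME, letters unpacked at the truncation `m + 1` resp. `1`);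
* §2 **`exists_threshold_sockHFP_pair`** — ∃ `c_F(d, L, B₀, B₀′, B₀′_H, B₂′, B_G, B_R, c_b9, c_L) > 0` such that AT EVERY member (any `η, k, Ω, Λs, Λb` with the
  `ZdIdx` laws + towers at every truncation + index law №8) `SockLetters … c_L …` and `SB9all` give BOTH `SockHFP₀ … c_F …` and `SockHFP … c_F …` — the form the knit
  consumes (one threshold for the whole family).

HONEST SCOPE.  Composition by name; nothing of Proposition 5's contraction, of [4] (the letters and the b9 socket are hypotheses) or of Sect. E is proved here beyond
what the imported modules prove.  Count-neutral; N05 NOT discharged; one finite T⁴ programme at fixed ε; nothing continuum / ℝ⁴ / OS / mass-gap / Clay.  Unit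
`pub-ymgap-dag-n05-d` (g0), 2026-08-26.
-/

noncomputable section

open NormedSpace

namespace Literature.MathematicalPhysics.QuantumFieldTheory.Balaban1983to89.B8SockHFPOfSockLetters

open B7Prop1Explicit B7Prop2Explicit B7Prop1Local
open B8Ineq130 (tlo thi)
open B8Thm2LogB (blockTop)
open B8LeafModelZd3 (SockB9P3)
open B8LeafModelZdOfHFP (SockHFP₀ SockHFP)
open B8LeafModelZdSockLetters (SockLetters)
open B8SockHFPAssembly (sockHFP_body_of_join sockHFP₀_body_of_join)
open B8SockHFPWindows (hfpWindows_of_guard)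
open B7Prop2Explicit (C0 c2')
open B7Prop3Flat (c3)
open B7Prop10General (C6 C4G)
open B7Prop9Flat (C5')
open B8Ineq125Concrete (C2p)
open B8Prop5ContractionKLevel (Mc Kc)
open QuantumLattice (blockSites)

-- `Site` alone could resolve to the torus sites of `Setup.lean`; re-export the `ℤ^d` sites of `B7Prop1Explicit`.
export B7Prop1Explicit (Site)

variable {d : ℕ} {𝔸 : Type*} [CStarAlgebra 𝔸] [Nontrivial 𝔸]

/-! ## §1 The sockets at ONE member from the letters socket, the b9 socket, the geometry laws and a windows family -/

section OneMember

variable {L : ℕ} {η : ℝ} {k : ℕ} {Ω : ℕ → Set (Site d)} {Λs : ℕ → ℕ → Set (Site d)} {Λb : ℕ → ℕ → Set (Site d × Fin d)}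
  {B₀ B₀' B₀'H B₂' BG BR cB9 cL cP B₀β β : ℝ} {len : Site d → ℝ}

/-- **`SockHFP` AT ONE MEMBER FROM THE [4]-LETTERS SOCKET** — Proposition 5's fixed point in plain currency for every level-`m` datum of Theorem 4's induction
(`1 ≤ m < k`), from: the letters socket `SockLetters … c_L …` (unpacked at the truncation `m + 1`, regularity `α₀ ≤ c_P ≤ c_L`), the b9 socket at level `m`
(`SB9all`), the member's `ZdIdx` laws (`Ω` antitone, `hbox`, `hclass`), towers inside `Ω_j` at every truncation (`htw`), index law №8 (`h8lt`, `h8top`), and a windows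
family below `c_P` in the shape of `B8SockHFPWindows.hfpWindows_of_guard`; proof = `B8SockHFPAssembly.sockHFP_body_of_join` at `c_B = c_A = L·c⋆`, `c_DA = 2dL²·c⋆`.
[cite: Balaban1985RegularSpaces, Prop. 5 (1.106)–(1.109) p.94, Thm 4 p.88, (1.67)–(1.69) p.88, p.89] -/
theorem sockHFP_of_sockLetters (hd2 : 2 ≤ d) (hL : 2 ≤ L) (hη : 0 < η) (hΩ : ∀ j, Ω (j + 1) ⊆ Ω j)
    (hbox : ∀ m, m ≤ k → ∀ j, j ≤ m → ∀ c ∈ Λb m j, ∀ x, InBox (loK L j c.1) (bondHiK L j c.1 c.2) x → x ∈ Ω j)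
    (hclass : ∀ m, m ≤ k → ∀ j, j ≤ m → ∀ c ∈ Λb m j,
      (c.1 ∈ Λs m j ∧ c.1 + e c.2 ∈ Λs m j) ∨
      (∃ j', j = j' + 1 ∧ (∀ x, (L : ℤ) • c.1 ≤ x → x ≤ (L : ℤ) • c.1 + blockTop L → x ∈ Λs m j') ∧ c.1 + e c.2 ∈ Λs m j) ∨
      (∃ j', j = j' + 1 ∧ c.1 ∈ Λs m j ∧ (∀ x, (L : ℤ) • (c.1 + e c.2) ≤ x → x ≤ (L : ℤ) • (c.1 + e c.2) + blockTop L → x ∈ Λs m j')))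
    (htw : ∀ m, m ≤ k → ∀ j, j ≤ m → ∀ y ∈ Λs m j, ∀ x, InBox (tlo L y j) (thi L y j) x → x ∈ Ω j)
    (h8lt : ∀ m, m < k → ∀ j, j < m → Λs m j = Λs (m + 1) j)
    (h8top : ∀ m, m < k → ∀ x, x ∈ Λs m m ↔ x ∈ Λs (m + 1) m ∨ ∃ y ∈ Λs (m + 1) (m + 1), x ∈ blockSites L y)
    (hB₀ : 0 < B₀) (hB₀' : 0 < B₀') (hB₀'H : 0 < B₀'H) (hB₂' : 0 ≤ B₂') (hBG : 0 ≤ BG) (hBR : 0 ≤ BR)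
    (SLet : SockLetters (𝔸 := 𝔸) L BG BR B₀'H B₂' cL η k Ω Λs)
    (SB9all : ∀ m, m ≤ k → SockB9P3 (𝔸 := 𝔸) L B₀ B₀β cB9 β len η m Ω Λs Λb) (hcPL : cP ≤ cL)
    (hwin : ∀ α₀ α₁ : ℝ, 0 < α₀ → 0 < α₁ → α₀ + α₁ ≤ cP →
      ∀ cs α₄ cB cDA hE hE₂ lE lE₂ : ℝ, cs = 5 * (d : ℝ) * L * B₀ * (α₀ + α₁) → α₄ = 8 * B₀' * (5 * (d : ℝ) * L * B₀) * (α₀ + α₁) →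
      cB = L * cs → cDA = 2 * (d : ℝ) * (L : ℝ) ^ 2 * cs →
      hE = B₀'H * (C2p d * (40 * d * cB + α₄) * α₄) → hE₂ = B₂' * (C2p d * (40 * d * cB + α₄) * α₄) →
      lE = B₀'H * (4 * C2p d * (40 * d * cB + 2 * α₄)) → lE₂ = B₂' * (4 * C2p d * (40 * d * cB + 2 * α₄)) →
      36 * d * B₀ * cs ≤ 1 / 2 ∧
      8 * (131072 * ((d : ℝ) + 1) ^ 2) * Real.exp (4 * (800 * ((d : ℝ) + 1) ^ 2 * ((d : ℝ) + 4)) * α₀) ≤ 16 * (131072 * ((d : ℝ) + 1) ^ 2) ∧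
      2 * cs ^ 2 + 20 * d * α₀ * cs + 2 * (16 * (131072 * ((d : ℝ) + 1) ^ 2)) * cs ^ 2 ≤ α₀ + α₁ ∧
      (d : ℝ) * L * α₁ ≤ 1 / 8 ∧
      α₀ ≤ cB9 ∧ cs ≤ cB9 ∧
      C0 d * α₀ ≤ 1 / 3 ∧ 4 * α₀ ≤ c2' d L ∧
      Real.exp (4 * (800 * ((d : ℝ) + 1) ^ 2 * ((d : ℝ) + 4)) * α₀) * (1 + 8 * (131072 * ((d : ℝ) + 1) ^ 2) * cB) ≤ 2 ∧
      2 * cB ≤ c3 d L ∧ 2048 * (d : ℝ) * cB ≤ 1 ∧ 40 * d * cB ≤ 1 / 200 ∧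
      200 * C6 d * (2 * α₄) ≤ 1 ∧ 12000 * ((d : ℝ) + 1) * L * (2 * α₄) ≤ 1 ∧
      C4G d L * (α₀ + 40 * d * cB + 4 * (2 * α₄)) ≤ 1 ∧
      1024 * ((d : ℝ) + 1) * ((d : ℝ) + 4) * L ^ 2 * α₀ ≤ 1 ∧ 32 * ((d : ℝ) + 1) ^ 2 * C6 d * L ^ 2 * α₀ ≤ 1 ∧
      16 * d * C5' d * C6 d * (L : ℝ) ^ 2 * α₀ ≤ 1 ∧ 8 * d * C6 d * L * α₀ ≤ 1 ∧
      40 * d * cB + α₄ ≤ 1 / (4 * B₀'H * (2 * C2p d)) ∧ 2 * C6 d * (40 * d * cB + 4 * α₄) ≤ 1 / 8 ∧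
      cB ≤ 1 / 13 ∧ α₄ / 4 + hE ≤ 1 / 24 ∧ α₄ / 4 + hE ≤ 1 / 140 ∧ 10 * (α₄ / 4 + hE) * BR ≤ 1 / 2 ∧
      BG * Mc d BR (α₄ / 4 + hE) cB hE₂ cDA ≤ α₄ / 4 ∧
      BG * Kc d BR (α₄ / 4 + hE) cB hE₂ cDA lE₂ (1 + lE) (1 + lE) ≤ 1 / 2) :
    SockHFP (𝔸 := 𝔸) L B₀ B₀' cP η k Ω Λs := by
  intro α₀ α₁ hα₀ hα₁ hs U₀ U' hU₀ hU' h33 h34 hAx h135 _ m hm1 hmk u₁ U₁ A hu₁ _ hW h129 hLan hdat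
  -- the windows at this (α₀, α₁)
  obtain ⟨hside, hC₂, h61, hsmall₁, hα₀9, hcs9, hα3, hα4, hsmall, hc₃, hsc, hα₃', hs₁, hs₂, hs₃, hs₄, hs₅, hs₆, hs₇, hsm, hprod8, hcA', ha₁',
    hb₁', hθ, h103, h106⟩ := hwin α₀ α₁ hα₀ hα₁ hs _ _ _ _ _ _ _ _ rfl rfl rfl rfl rfl rfl rfl rfl
  -- the letters at the truncation `m + 1`
  have hα₀L : α₀ ≤ cL := by linarith
  obtain ⟨g, Δ, q, qs, Aw, c, H', g_left, g_right, c_right, hΔ, hqs, hq, hH0, hH1, hH2, hHsupp, hHequiv, hQH, hG, hGsupp, hGreal, hRbd, hRreal⟩ :=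
    SLet α₀ hα₀ hα₀L U₀ hU₀ h33 (m + 1) (by omega) hmk
  have hcs0 : 0 ≤ 5 * (d : ℝ) * L * B₀ * (α₀ + α₁) := by
    have : 0 ≤ α₀ + α₁ := by linarith
    positivity
  have hcDAlo : (d : ℝ) * (L : ℝ) ^ 2 * (5 * (d : ℝ) * L * B₀ * (α₀ + α₁)) ≤ 2 * (d : ℝ) * (L : ℝ) ^ 2 * (5 * (d : ℝ) * L * B₀ * (α₀ + α₁)) := by
    have h := mul_nonneg (by positivity : (0 : ℝ) ≤ (d : ℝ) * (L : ℝ) ^ 2) hcs0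
    linarith only [h]
  exact sockHFP_body_of_join hd2 hL hη hΩ hbox hclass hm1 hmk (htw (m + 1) hmk) (h8lt m hmk) (h8top m hmk) hα₀ hα₁ hB₀ hB₀' rfl rfl hU₀ hU'
    h33 h34 hAx h135 hu₁ hW h129 hLan hdat (SB9all m hmk.le) hα₀9 hcs9 hside hC₂ h61 hsmall₁ g Δ q qs Aw c g_left g_right c_right hΔ hqs hq H'
    hB₀'H hB₂' hBG hBR hH0 hH1 hH2 hHsupp hHequiv hQH hG hGsupp hGreal hRbd hRreal le_rfl le_rfl hcDAlo hα3 hα4 hsmall hc₃ hsc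
    hα₃' hs₁ hs₂ hs₃ hs₄ hs₅ hs₆ hs₇ hsm hprod8 rfl rfl rfl rfl hcA' ha₁' hb₁' hθ h103 h106

/-- **`SockHFP₀` AT ONE MEMBER FROM THE [4]-LETTERS SOCKET** — the base datum (`u₁ = 1`, `U₁ = U′`, p. 89); the letters at the truncation `1`, towers of `Λs 1` inside
`Ω_j`, the windows family below `c_P` (no b9 socket and no index law are read); proof = `B8SockHFPAssembly.sockHFP₀_body_of_join`.
[cite: Balaban1985RegularSpaces, Prop. 5 (1.106)–(1.109) p.94, p.89 (the start of the induction)] -/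
theorem sockHFP₀_of_sockLetters (hd2 : 2 ≤ d) (hL : 2 ≤ L) (hη : 0 < η) (hk : 1 ≤ k) (hΩ : ∀ j, Ω (j + 1) ⊆ Ω j)
    (htw : ∀ m, m ≤ k → ∀ j, j ≤ m → ∀ y ∈ Λs m j, ∀ x, InBox (tlo L y j) (thi L y j) x → x ∈ Ω j)
    (hB₀ : 0 < B₀) (hB₀' : 0 < B₀') (hB₀'H : 0 < B₀'H) (hB₂' : 0 ≤ B₂') (hBG : 0 ≤ BG) (hBR : 0 ≤ BR)
    (SLet : SockLetters (𝔸 := 𝔸) L BG BR B₀'H B₂' cL η k Ω Λs) (hcPL : cP ≤ cL)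
    (hwin : ∀ α₀ α₁ : ℝ, 0 < α₀ → 0 < α₁ → α₀ + α₁ ≤ cP →
      ∀ cs α₄ cB cDA hE hE₂ lE lE₂ : ℝ, cs = 5 * (d : ℝ) * L * B₀ * (α₀ + α₁) → α₄ = 8 * B₀' * (5 * (d : ℝ) * L * B₀) * (α₀ + α₁) →
      cB = L * cs → cDA = 2 * (d : ℝ) * (L : ℝ) ^ 2 * cs →
      hE = B₀'H * (C2p d * (40 * d * cB + α₄) * α₄) → hE₂ = B₂' * (C2p d * (40 * d * cB + α₄) * α₄) →
      lE = B₀'H * (4 * C2p d * (40 * d * cB + 2 * α₄)) → lE₂ = B₂' * (4 * C2p d * (40 * d * cB + 2 * α₄)) →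
      36 * d * B₀ * cs ≤ 1 / 2 ∧
      8 * (131072 * ((d : ℝ) + 1) ^ 2) * Real.exp (4 * (800 * ((d : ℝ) + 1) ^ 2 * ((d : ℝ) + 4)) * α₀) ≤ 16 * (131072 * ((d : ℝ) + 1) ^ 2) ∧
      2 * cs ^ 2 + 20 * d * α₀ * cs + 2 * (16 * (131072 * ((d : ℝ) + 1) ^ 2)) * cs ^ 2 ≤ α₀ + α₁ ∧
      (d : ℝ) * L * α₁ ≤ 1 / 8 ∧
      α₀ ≤ cB9 ∧ cs ≤ cB9 ∧
      C0 d * α₀ ≤ 1 / 3 ∧ 4 * α₀ ≤ c2' d L ∧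
      Real.exp (4 * (800 * ((d : ℝ) + 1) ^ 2 * ((d : ℝ) + 4)) * α₀) * (1 + 8 * (131072 * ((d : ℝ) + 1) ^ 2) * cB) ≤ 2 ∧
      2 * cB ≤ c3 d L ∧ 2048 * (d : ℝ) * cB ≤ 1 ∧ 40 * d * cB ≤ 1 / 200 ∧
      200 * C6 d * (2 * α₄) ≤ 1 ∧ 12000 * ((d : ℝ) + 1) * L * (2 * α₄) ≤ 1 ∧
      C4G d L * (α₀ + 40 * d * cB + 4 * (2 * α₄)) ≤ 1 ∧
      1024 * ((d : ℝ) + 1) * ((d : ℝ) + 4) * L ^ 2 * α₀ ≤ 1 ∧ 32 * ((d : ℝ) + 1) ^ 2 * C6 d * L ^ 2 * α₀ ≤ 1 ∧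
      16 * d * C5' d * C6 d * (L : ℝ) ^ 2 * α₀ ≤ 1 ∧ 8 * d * C6 d * L * α₀ ≤ 1 ∧
      40 * d * cB + α₄ ≤ 1 / (4 * B₀'H * (2 * C2p d)) ∧ 2 * C6 d * (40 * d * cB + 4 * α₄) ≤ 1 / 8 ∧
      cB ≤ 1 / 13 ∧ α₄ / 4 + hE ≤ 1 / 24 ∧ α₄ / 4 + hE ≤ 1 / 140 ∧ 10 * (α₄ / 4 + hE) * BR ≤ 1 / 2 ∧
      BG * Mc d BR (α₄ / 4 + hE) cB hE₂ cDA ≤ α₄ / 4 ∧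
      BG * Kc d BR (α₄ / 4 + hE) cB hE₂ cDA lE₂ (1 + lE) (1 + lE) ≤ 1 / 2) :
    SockHFP₀ (𝔸 := 𝔸) L B₀ B₀' cP η k Ω Λs := by
  intro α₀ α₁ hα₀ hα₁ hs U₀ U' hU₀ _ h33 h34 hAx _ _ A hdat
  obtain ⟨-, -, -, -, -, -, hα3, hα4, hsmall, hc₃, hsc, hα₃', hs₁, hs₂, hs₃, hs₄, hs₅, hs₆, hs₇, hsm, hprod8, hcA', ha₁', hb₁', hθ, h103, h106⟩ :=
    hwin α₀ α₁ hα₀ hα₁ hs _ _ _ _ _ _ _ _ rfl rfl rfl rfl rfl rfl rfl rfl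
  have hα₀L : α₀ ≤ cL := by linarith
  obtain ⟨g, Δ, q, qs, Aw, c, H', g_left, g_right, c_right, hΔ, hqs, hq, hH0, hH1, hH2, hHsupp, hHequiv, hQH, hG, hGsupp, hGreal, hRbd, hRreal⟩ :=
    SLet α₀ hα₀ hα₀L U₀ hU₀ h33 1 le_rfl hk
  exact sockHFP₀_body_of_join hd2 hL hη hk hΩ (htw 1 hk) hα₀ hα₁ hB₀ hB₀' rfl rfl hU₀ h33 h34 hAx hdat g Δ q qs Aw c g_left g_right c_right hΔ
    hqs hq H' hB₀'H hB₂' hBG hBR hH0 hH1 hH2 hHsupp hHequiv hQH hG hGsupp hGreal hRbd hRreal le_rfl le_rfl le_rfl hα3 hα4 hsmall hc₃ hsc hα₃' hs₁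
    hs₂ hs₃ hs₄ hs₅ hs₆ hs₇ hsm hprod8 rfl rfl rfl rfl hcA' ha₁' hb₁' hθ h103 h106

end OneMember

/-! ## §2 ONE threshold for the whole family: `SockHFP₀` and `SockHFP` at every member from the letters socket and the b9 socket -/

/-- **THE PROPOSITION-5 SOCKETS OF THE N05 KNIT FROM THE [4]-LETTERS SOCKET, BELOW ONE THRESHOLD** — for `d, L ≥ 2`, the knit's inputs `B₀, B₀′ > 0` with
`2 ≤ 5dLB₀`, [4]-letters constants `B₀′_H > 0`, `B₂′, B_G, B_R ≥ 0` with threshold `c_L > 0`, a b9 threshold `c_b9 > 0`, and the free-constant condition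
`3·(2dL²)·B_G·B_R ≤ B₀′` (the socket's `B₀′` absorbs the `D*A`-term, p. 93), there is `c_F > 0` such that AT EVERY member (`η > 0`, `k ≥ 1`, `Ω` antitone, `Λs`, `Λb`
with the `ZdIdx` laws `hbox`/`hclass`, towers inside `Ω_j` AT EVERY TRUNCATION, INDEX LAW №8) the letters socket `SockLetters L B_G B_R B₀′_H B₂′ c_L η k Ω Λs` and
the b9 socket at every truncation give `SockHFP₀ L B₀ B₀′ c_F η k Ω Λs` AND `SockHFP L B₀ B₀′ c_F η k Ω Λs` (`c_F = min(c_P, c_L)`, `c_P` of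
`B8SockHFPWindows.hfpWindows_of_guard`).  This is Theorem 4's «there exists a constant c₁» with the Proposition-5 socket served by [4]'s letters.
[cite: Balaban1985RegularSpaces, Prop. 5 (1.106)–(1.109) p.94, Thm 4 p.88 («there exists a constant c₁»), (1.102)–(1.103) p.93, p.89] -/
theorem exists_threshold_sockHFP_pair (hd2 : 2 ≤ d) {L : ℕ} (hL : 2 ≤ L) {B₀ B₀' B₀'H B₂' BG BR cB9 cL : ℝ} (hB₀ : 0 < B₀) (hB₀' : 0 < B₀')
    (hB : 2 ≤ 5 * (d : ℝ) * L * B₀) (hB₀'H : 0 < B₀'H) (hB₂' : 0 ≤ B₂') (hBG : 0 ≤ BG) (hBR : 0 ≤ BR) (hcB9 : 0 < cB9) (hcL : 0 < cL)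
    (hfree : 3 * (2 * (d : ℝ) * (L : ℝ) ^ 2) * BG * BR ≤ B₀') :
    ∃ cF : ℝ, 0 < cF ∧ ∀ {η : ℝ}, 0 < η → ∀ {k : ℕ}, 1 ≤ k → ∀ {Ω : ℕ → Set (Site d)}, (∀ j, Ω (j + 1) ⊆ Ω j) →
      ∀ {Λs : ℕ → ℕ → Set (Site d)} {Λb : ℕ → ℕ → Set (Site d × Fin d)},
      (∀ m, m ≤ k → ∀ j, j ≤ m → ∀ c ∈ Λb m j, ∀ x, InBox (loK L j c.1) (bondHiK L j c.1 c.2) x → x ∈ Ω j) →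
      (∀ m, m ≤ k → ∀ j, j ≤ m → ∀ c ∈ Λb m j,
        (c.1 ∈ Λs m j ∧ c.1 + e c.2 ∈ Λs m j) ∨
        (∃ j', j = j' + 1 ∧ (∀ x, (L : ℤ) • c.1 ≤ x → x ≤ (L : ℤ) • c.1 + blockTop L → x ∈ Λs m j') ∧ c.1 + e c.2 ∈ Λs m j) ∨
        (∃ j', j = j' + 1 ∧ c.1 ∈ Λs m j ∧ (∀ x, (L : ℤ) • (c.1 + e c.2) ≤ x → x ≤ (L : ℤ) • (c.1 + e c.2) + blockTop L → x ∈ Λs m j'))) →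
      (∀ m, m ≤ k → ∀ j, j ≤ m → ∀ y ∈ Λs m j, ∀ x, InBox (tlo L y j) (thi L y j) x → x ∈ Ω j) →
      (∀ m, m < k → ∀ j, j < m → Λs m j = Λs (m + 1) j) →
      (∀ m, m < k → ∀ x, x ∈ Λs m m ↔ x ∈ Λs (m + 1) m ∨ ∃ y ∈ Λs (m + 1) (m + 1), x ∈ blockSites L y) →
      ∀ {B₀β β : ℝ} {len : Site d → ℝ},
      SockLetters (𝔸 := 𝔸) L BG BR B₀'H B₂' cL η k Ω Λs → (∀ m, m ≤ k → SockB9P3 (𝔸 := 𝔸) L B₀ B₀β cB9 β len η m Ω Λs Λb) →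
        SockHFP₀ (𝔸 := 𝔸) L B₀ B₀' cF η k Ω Λs ∧ SockHFP (𝔸 := 𝔸) L B₀ B₀' cF η k Ω Λs := by
  have hd1 : 1 ≤ d := le_trans (by norm_num) hd2
  have hL1 : 1 ≤ L := le_trans (by norm_num) hL
  obtain ⟨cP, hcP, hwin⟩ := hfpWindows_of_guard hd1 hL1 hB₀ hB₀' hB hB₀'H hB₂' hBG hBR hcB9 hfree
  refine ⟨min cP cL, lt_min hcP hcL, ?_⟩
  intro η hη k hk Ω hΩ Λs Λb hbox hclass htw h8lt h8top B₀β β len SLet SB9all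
  have hwin' : ∀ α₀ α₁ : ℝ, 0 < α₀ → 0 < α₁ → α₀ + α₁ ≤ min cP cL → _ :=
    fun α₀ α₁ hα₀ hα₁ hs => hwin α₀ α₁ hα₀ hα₁ (hs.trans (min_le_left _ _))
  exact ⟨sockHFP₀_of_sockLetters hd2 hL hη hk hΩ htw hB₀ hB₀' hB₀'H hB₂' hBG hBR SLet (min_le_right _ _) hwin',
    sockHFP_of_sockLetters hd2 hL hη hΩ hbox hclass htw h8lt h8top hB₀ hB₀' hB₀'H hB₂' hBG hBR SLet SB9all (min_le_right _ _) hwin'⟩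

#print axioms sockHFP_of_sockLetters
#print axioms sockHFP₀_of_sockLetters
#print axioms exists_threshold_sockHFP_pair

end Literature.MathematicalPhysics.QuantumFieldTheory.Balaban1983to89.B8SockHFPOfSockLetters

end
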